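import Summits.ResolutionOfSingularities.ResolutionOfSingularities.Theorems.WeightedInvariantTieFiniteCurveClosed
import Summits.ResolutionOfSingularities.ResolutionOfSingularities.Theorems.WeightedInvariantIota3EpsStrat
import Summits.ResolutionOfSingularities.ResolutionOfSingularities.Theorems.WeightedInvariantHypersurfaceLocalGameEFT4SDimLETwoOpenClosedPoint
import Mathlib.RingTheory.Ideal.KrullsHeightTheorem
import HarnessLib

/-!
# Finiteness of the tie points — three pointwise facts for the scheme step: a tie position has order `≥ 2`; the stratum prime of a
# tie position is the MAXIMAL equal-order generization; the lex-maximal datum is insensitive to unit rescaling (door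
# `HypersurfaceCentreConstruction`, stmt-ResolutionOfSingularities-19897, route `WeightedInvariant`, P3 rung `KeyRungGrLE 3 p`, letter `τ`)

[OURS · L1 W4.3 · cell `res-hironaka`, HUMAN RULING D-0089] Helper file `--supports stmt-ResolutionOfSingularities-19897` (line
`local-engine` of res-L1-w43-plan-1, spec `L/res-type-047/D2-INCHART-SPEC-v2.md` §2 — the inputs of the scheme corollary that turns the
ring-level in-chart theorem `TieFinite.finite_tiePrimes` into the binder `hcurve` of `TieFinite.tiePoints_finite_of_curveFinite'`).
* §1 `TieFinite.IsTiePosition.two_le_order` — if `(S, g)` is a tie position (`Iota3.IsTiePosition`, res-type-092) and `g ∈ 𝔪^ν ∖ 𝔪^{ν+1}`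
  then `2 ≤ ν` (so a curve of order `≤ 1` carries no tie point; res-type-098's AQS drop needs `ν ≥ 2`).  Proof: a minimal prime `𝔭`
  over `(g)` has height `≤ 1` (Krull) and, when `ν = 1`, lies in the top `(ν ; ε)`-stratum, so `P₀ ≤ 𝔭` — against `ht P₀ ≥ 2`
  (`IsTiePosition.two_le_height`, p540078).
* §2 `TieFinite.IsTiePosition.topStratumPrime_eq_of_maximal` — for a tie position, a prime `𝔭` with `ν(S_𝔭) = ν(S)` such that `ν`
  drops at every prime strictly below `𝔭` IS the stratum prime `P₀` (identification (O4) of the spec: along the curve of a maximal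
  point `η`, `P₀(z′) = 𝔭_η` at every tie point `z′` of the fibre).
* §3 `TieFinite.isLexMaxWeightedCentreGerm_unit_mul` — `IsLexMaxWeightedCentreGerm` is unchanged when the parameters are multiplied
  by units (spreading the germs of a tie presentation to sections of an affine chart changes them by units).

[OURS] Replaces the role of NO printed item; NOT a statement of the manuscript under review [claim: Hironaka2017, status:
under-review].  AI work, weaker than expert review.  Def-free.

## References

* H. Matsumura, *Commutative Ring Theory*, Thm. 13.5 (Krull's principal ideal theorem). [Matsumura1987]
* D. Abramovich, M. H. Quek, B. Schober, arXiv:2507.01232 (v3, 2026), Thm 3.5. [AbramovichQuekSchober2025]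
-/

noncomputable section

set_option linter.dupNamespace false -- mandated namespace `Summit.<Summit>.<Problem>` of this single-conjunct summit

open IsLocalRing Literature.AlgebraicGeometry.Resolution
open Summit.ResolutionOfSingularities.ResolutionOfSingularities.Theorems

namespace Summit.ResolutionOfSingularities.ResolutionOfSingularities.Cruxes.HypersurfaceCentreConstruction.LocalEngine

namespace TieFinite

variable {S : Type} [CommRing S] [IsRegularLocalRing S]

/-! ## §1 A tie position has order at least two -/

/-- `ord g = 1` read in `iotaOrd`. [folklore] -/
theorem iotaOrd_eq_one_of_mem_of_not_mem_sq {g : S} (h1 : g ∈ maximalIdeal S) (h2 : g ∉ maximalIdeal S ^ 2) :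
    iotaOrd S g = 1 := by
  rw [iotaOrd_eq_ordOfENat_adicOrder, (adicOrder_eq_one_iff g).mpr ⟨h1, h2⟩, ← Nat.cast_one, ordOfENat_natCast, Nat.cast_one]

/-- **A TIE POSITION HAS ORDER AT LEAST TWO**: if `(S, g)` is a tie position and `g ∈ 𝔪^ν ∖ 𝔪^{ν+1}` then `2 ≤ ν`.
[cite: Matsumura1987, Thm. 13.5] -/
theorem IsTiePosition.two_le_order {g : S} (hz : Iota3.IsTiePosition S g) {ν : ℕ} (hν : g ∈ maximalIdeal S ^ ν)
    (hν' : g ∉ maximalIdeal S ^ (ν + 1)) : 2 ≤ ν := by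
  classical
  obtain ⟨_, hgm⟩ := IsTiePosition.mem_maximalIdeal hz
  by_contra hlt
  have hν1 : ν = 0 ∨ ν = 1 := by omega
  rcases hν1 with rfl | rfl
  · exact hν' (by rw [zero_add, pow_one]; exact hgm)
  -- `ν = 1`: `g ∈ 𝔪 ∖ 𝔪²`
  rw [show (1 : ℕ) + 1 = 2 from rfl] at hν'
  obtain ⟨_, h2⟩ := IsTiePosition.two_le_height hz
  have hε : Iota3.iotaEps S g = 0 := hz.2.2.1
  -- a minimal prime over `(g)`
  have hne : Ideal.span ({g} : Set S) ≠ ⊤ := by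
    rw [Ne, Ideal.span_singleton_eq_top]
    exact fun hu => (IsLocalRing.mem_maximalIdeal _).mp hgm hu
  obtain ⟨⟨𝔭, h𝔭⟩⟩ := Ideal.nonempty_minimalPrimes hne
  haveI h𝔭p : 𝔭.IsPrime := h𝔭.1.1
  have hg𝔭 : g ∈ 𝔭 := h𝔭.1.2 (Ideal.mem_span_singleton_self g)
  have hht : 𝔭.height ≤ 1 := Ideal.height_le_one_of_isPrincipal_of_mem_minimalPrimes (Ideal.span {g}) 𝔭 h𝔭
  -- `𝔭` lies in the top `(ν ; ε)`-stratum
  have hνS : iotaOrd S g = 1 := iotaOrd_eq_one_of_mem_of_not_mem_sq hgm hν'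
  have hν𝔭 : iotaOrd (Localization.AtPrime 𝔭) (algebraMap S (Localization.AtPrime 𝔭) g) = 1 := by
    refine le_antisymm (hνS ▸ iotaOrd_generizationMonotone S 𝔭 g) ?_
    have h := (natCast_le_iotaOrd_iff (Localization.AtPrime 𝔭) (algebraMap S _ g) 1).mpr (by
      rw [pow_one, ← Localization.AtPrime.map_eq_maximalIdeal]; exact Ideal.mem_map_of_mem _ hg𝔭)
    exact_mod_cast h
  have hmem : (⟨𝔭, h𝔭p⟩ : PrimeSpectrum S) ∈ ContactCylinder.topStratum Iota3.iotaOrdEps S g := by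
    rw [ContactCylinder.mem_topStratum_iff]
    refine le_antisymm (Iota3.iotaOrdEps_generizationMonotone S 𝔭 g) ?_
    rw [Iota3.iotaOrdEps_le_iff]
    refine Or.inr ⟨?_, ?_⟩
    · change iotaOrd S g = iotaOrd (Localization.AtPrime 𝔭) (algebraMap S _ g)
      rw [hνS, hν𝔭]
    · rw [hε]; exact zero_le
  have hle := ContactCylinder.topStratumPrime_le Iota3.iotaOrdEps S g hmem
  have hP₀ : (ContactCylinder.topStratumPrime Iota3.iotaOrdEps S g).height ≤ 1 := (Ideal.height_mono hle).trans hht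
  have h21 : (2 : ℕ∞) ≤ 1 := h2.trans hP₀
  exact absurd h21 (by decide)

/-! ## §2 The stratum prime is the maximal equal-order generization -/

omit [IsRegularLocalRing S] in
/-- **(O4)** For a tie position `(S, g)`: a prime `𝔭` at which the order of `g` equals `ν(S)` and below which (at every prime
`𝔮 < 𝔭`) the order drops is the generic prime `P₀` of the top `(ν ; ε)`-stratum. [OURS] -/
theorem IsTiePosition.topStratumPrime_eq_of_maximal {g : S} (hz : Iota3.IsTiePosition S g) (𝔭 : Ideal S) [𝔭.IsPrime]
    (hν : iotaOrd (Localization.AtPrime 𝔭) (algebraMap S (Localization.AtPrime 𝔭) g) = iotaOrd S g)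
    (hmax : ∀ (𝔮 : Ideal S) [𝔮.IsPrime], 𝔮 < 𝔭 →
      iotaOrd (Localization.AtPrime 𝔮) (algebraMap S (Localization.AtPrime 𝔮) g) < iotaOrd S g) :
    ContactCylinder.topStratumPrime Iota3.iotaOrdEps S g = 𝔭 := by
  obtain ⟨ν, hP₀, hνeq, hνP₀, hdrop⟩ := IsTiePosition.iotaOrd_localization_lt hz
  have hle : ContactCylinder.topStratumPrime Iota3.iotaOrdEps S g ≤ 𝔭 := by
    by_contra hnot
    have h := hdrop 𝔭 hnot
    rw [hν, hνeq] at h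
    exact lt_irrefl _ h
  rcases hle.lt_or_eq with hlt | heq
  · have h := hmax _ hlt
    rw [hνP₀, hνeq] at h
    exact absurd h (lt_irrefl _)
  · exact heq

/-! ## §3 The lex-maximal datum under unit rescaling -/

omit [IsRegularLocalRing S] in
/-- **Unit rescaling of the parameters preserves the lex-maximal admissible weighted centre germ** (same span, same weighted
filtration — `GenericEquimultiplicity.weightedMonomialIdeal_unit_mul`). [cite: AbramovichQuekSchober2025, Thm 3.5] -/
theorem isLexMaxWeightedCentreGerm_unit_mul [IsLocalRing S] {I : Ideal S} {x : Fin 2 → S} {w : Fin 2 → ℕ} {ℓ : ℕ}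
    (h : IsLexMaxWeightedCentreGerm S I x w ℓ) (c : Fin 2 → S) (hc : ∀ i, IsUnit (c i)) :
    IsLexMaxWeightedCentreGerm S I (fun i => c i * x i) w ℓ := by
  obtain ⟨hspan, hpos, hcop, hle, hℓ, hdvd, hadm, hmax, huniq⟩ := h
  have heq : ∀ n, weightedMonomialIdeal (fun i => c i * x i) w n = weightedMonomialIdeal x w n :=
    fun n => GenericEquimultiplicity.weightedMonomialIdeal_unit_mul x c hc w n
  have hspan' : Ideal.span (Set.range fun i => c i * x i) = maximalIdeal S := by
    rw [← hspan]
    apply le_antisymm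
    · rw [Ideal.span_le]
      rintro _ ⟨i, rfl⟩
      exact Ideal.mul_mem_left _ _ (Ideal.subset_span ⟨i, rfl⟩)
    · rw [Ideal.span_le]
      rintro _ ⟨i, rfl⟩
      obtain ⟨u, hu⟩ := hc i
      have hx : x i = ↑u⁻¹ * (c i * x i) := by rw [← hu, Units.inv_mul_cancel_left]
      rw [SetLike.mem_coe, hx]
      exact Ideal.mul_mem_left _ _ (Ideal.subset_span ⟨i, rfl⟩)
  refine ⟨hspan', hpos, hcop, hle, hℓ, hdvd, by rw [heq]; exact hadm, hmax, fun y hy hyadm n => ?_⟩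
  rw [heq]
  exact huniq y hy hyadm n

end TieFinite

end Summit.ResolutionOfSingularities.ResolutionOfSingularities.Cruxes.HypersurfaceCentreConstruction.LocalEngine

end
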